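import Summits.BirchSwinnertonDyer.BirchSwinnertonDyer.Theses.UniversalToricDescent
import Summits.BirchSwinnertonDyer.BirchSwinnertonDyer.Theorems.UniversalToricDescentTwinAlgMuZeroAtThreeOfBetaRoadParam
import Summits.BirchSwinnertonDyer.BirchSwinnertonDyer.Theorems.UniversalToricDescentBetaRoadParamDefs
import Literature.NumberTheory.EllipticCurves.BertoliniDarmon2005.AdmissiblePrimes
import Mathlib.FieldTheory.Finite.GaloisField
import HarnessLib

/-!
# NODE `unipotent_bipartite` on `UniversalToricDescent.TwinAlgMuZeroAtThree` (stmt-BirchSwinnertonDyer-24737) — crux-ideate g3 (D-0171 node)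

NOT a registered line (LEAD's line of record stays `Lines/beta_road.lean` v19).  A compiling DECOMPOSITION NODE: `TwinAlgMuZeroAtThree_of` concludes
the crux BY NAME; `sorry` only inside `stub_*`; every piece tagged.

THE NEW LEVER (technique-differentiated from every recorded line/idea of this crux: Kolyvagin systems (beta-road K2a‴), signed ±/♯♭ theory
(signed-howard-half, C₀), Beilinson–Flach (dead), weight transport (dead), CM congruence (dead)):  **UNIPOTENT-ADMISSIBLE PRIMES AT `p = 3`**.
Bertolini–Darmon's `n`-admissible primes (Ann. Math. 2005 p. 18; tree `BertoliniDarmon2005.IsAdmissiblePrime`) require (3) `p ∤ ℓ² − 1`, which is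
EMPTY at `p = 3` (tree barrier `Literature.Barriers.BirchSwinnertonDyer.NoAdmissiblePrimesAtThree`, whose scope caveat (a) says «a transfer must
replace clause (3)»).  Clause (3) is used for exactly one thing (BD05 Lemma 2.6, p. 18 L36–54): Frobenius at the inert `ℓ` acts on `E[pⁿ]`
SEMISIMPLY with eigenvalues `±1, ±ℓ` DISTINCT mod `p`, whence `H¹_fin(K_ℓ, E[pⁿ])` and `H¹_sing(K_ℓ, E[pⁿ])` are free of rank ONE over `ℤ/pⁿ`
(«and not two», Remark 2 p. 19).  At `p = 3`, take instead inert `ℓ ≡ 1 (mod 3)` with `3ⁿ ∣ ℓ + 1 ∓ a_ℓ` and Frobenius NON-SEMISIMPLE on `E′[3]`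
(`ρ̄₃(Frob_ℓ) = ±(1 1; 0 1)` up to conjugacy — order 3 or 6 in `GL₂(𝔽₃)`; detected arithmetically by `#E′(𝔽_{ℓ²})[3] = 3`, not `9`).  Then in an
adapted basis `Frob_ℓ = ε·(1 c; 0 λ)` over `ℤ/3ⁿ` with `c` a unit and `λ ≡ ℓ ≡ 1 (mod 3)`, and a two-line computation (`UnipotentLocalRankOne`,
§2) gives `coker(F² − 1) ≅ ℤ/3ⁿ` (finite part) and `ker(F² − ℓ²) ≅ ℤ/3ⁿ` (singular part): Lemma 2.6's CONCLUSION without its hypothesis (3).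
The Jordan block replaces the distinct eigenvalues; the unique Frobenius-stable line `ker(F − ε)` replaces BD's Assumption 2.1 «unique
`±ε`-line» at the level-raised prime (multiplicity one at `ℓ` for the level-raised form fails classically only for SCALAR `ρ̄(Frob_ℓ) = ±1`).
Supply: Čebotarev in `K(E′[3])/ℚ` — `16/48` of `GL₂(𝔽₃)` is `±`(non-scalar unipotent), all of determinant `1`, and `K ∩ ℚ(E′[3]) = ℚ` because the
only quadratic subfield of `ℚ(E′[3])` is `ℚ(√−3)` while `3` splits in `K` — so `W'.HasSurjectiveModNGaloisRep 3`, a binder of the crux, is EXACTLY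
the supply hypothesis (density `1/6` at `n = 1`).  BD05's second use of `p > 3` (Thm. 3.2 p. 22: `T` of order prime to `p`, `(v,τ,T)^d = d v`)
is replaced by the direct computation `loc_ℓ(s) ≡ (1 + δε) v + δε N v (mod N·E′[3])`, nonzero for `ε = δ` and `v ∉ ker N` (this file's §0 note (ii)).

WHY IT BITES THIS CRUX (and why `n = 1` suffices): the B-chain of beta-road reads `μ = 0` off Howard's conclusion at the specialisations
`S_m = Λ/(T^m + 3)`, where `3 = π^m·unit`; K1 (`stub_principalHeegnerIndivisibleMult`, BY NAME) gives `𝐳 ∉ 3𝔖`, i.e. the bottom class has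
`π`-index `< m` at level `m`; a rigidity argument with coefficients `S_m/π^k`, `k ≤ m`, hence an `𝔽₃[π]/π^k`-module built from `E′[3]` ONLY, then needs
admissibility at `n = 1` only — which mod-`3` surjectivity supplies with no `3`-adic-image caveat (barrier `EulerSystemBigImageAtSmallImage` not met).

PIECES (D-0171 tags):
* `unipotentLocalRankOne` — WEAKER (pure linear algebra over `ZMod (3^n)`) — **PROVED in this node** (no longer a stub).
* `stub_unipotentAdmissibleSupply` — WEAKER (Čebotarev existence at `n = 1` from `HasSurjectiveModNGaloisRep 3` + `3` split in `K`); ATTACKABLE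
  (tree: `Automorphic.chebotarev_artinRep_holds`, `Howard2004.exists_inert_prime_isArithFrobAt_conjGal_mul` pattern); INSTRUMENTABLE (any bucket-B
  twin, e.g. list inert `ℓ < 2000` with `#E′(𝔽_{ℓ²})[3] = 3`).
* `stub_bipartiteHowardConclusionAtThree` — UNDECIDED / IDEA-NEEDED (the research constant K2♭-bip: a bipartite Euler system at `p = 3`, `3 ∥ N′`,
  over `S_m/π^k` from level raising at unipotent-admissible primes ⟹ Howard's `Conclusion` at the control levels; printed only for BD-admissible
  primes and `p ≥ 5`: BD05 Thm. 5.15/9.3, Howard 2006 Thm. 3.2.3, Skinner–Zhang arXiv:1407.1099 (`p ∥ N`), CHKLL arXiv:2308.10474 §7 (±)).  Its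
  leaves: (L1) Ribet level raising `N′ → N′ℓ` at `p = 3` for `a_ℓ ≡ ±(ℓ+1)` [ATTACKABLE: Ribet 1984/Diamond–Taylor 1994 allow `p = 3` when `ρ̄`
  is irreducible and not induced from `ℚ(√−3)` — here `ρ̄` is onto `GL₂(𝔽₃)`]; (L2) multiplicity one / freeness of the `𝔽₃`-quaternionic
  character space at non-scalar `Frob_ℓ` [IDEA-NEEDED; BARRIER-adjacent: the scalar case is the classical failure, the Jordan-block case is open in
  print]; (L3) first and second reciprocity laws at unipotent-admissible `ℓ` [IDEA-NEEDED: BD05 §8–9 use the component group `Φ_ℓ ≅ ℤ/(ℓ+1)·…` and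
  `p ∤ ℓ² − 1` once more in Cor. 5.18 — to be re-read with `3 ∣ ℓ − 1`]; (L4) the Tate-curve local condition at `v ∣ 3` for the twin (`3 ∥ N′`)
  [ATTACKABLE: Skinner–Zhang §3 shape].
* `stub_principalHeegnerIndivisibleMult` (K1‴) and `stub_goodSS` (C₀′) — BY NAME from beta_road v19 (COSTUME-free: the registered constants).
* `twinAlgMuZeroAtThree_mult_of_howardConclusionFlat` — PROVED here (the v19 B-chain with K2a‴ replaced by the engine-agnostic K2♭
  `HowardConclusionOfFamilyMultAtThree`); `TwinAlgMuZeroAtThree_of` — PROVED, concludes the crux BY NAME.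

Disproof.lean honoured: `SatisfiesHeegnerHypothesis` is load-bearing (inertness of `ℓ` in `K`, `degreeOne_of_dvd_of_heegner`, the Heegner family
`F`); no stub is an instance of `exists_generator_of_eq_top` / `conclusion_of_finite`; habitats `Negative/Habitat*.lean` untouched (B and C₀
antecedents are consistent).  BSD is proved for no curve by this file; 24737 stays OPEN.
-/

section Instrument

set_option linter.dupNamespace false

/-! ## Instrument (kernel-checked by `decide`, stated BEFORE `open scoped Classical`): the supply count in `GL₂(𝔽₃)` and the
rank-one shape at `n = 1`.  These are the D-0171 instrument data of the node. -/

set_option autoImplicit false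

namespace Summit.BirchSwinnertonDyer.BirchSwinnertonDyer.Cruxes.TwinAlgMuZeroAtThree.UnipotentBipartite.Instrument

/-- `#GL₂(𝔽₃) = 48`. -/
theorem card_gl2_f3 :
    (Finset.univ.filter (fun T : Matrix (Fin 2) (Fin 2) (ZMod 3) => T.det ≠ 0)).card = 48 := by
  decide

/-- Exactly `16` elements `T ∈ GL₂(𝔽₃)` are non-scalar `±`unipotent (`(T ∓ 1)² = 0`, `T ≠ ±1`): the Čebotarev class of unipotent-admissible
Frobenii has density `16/48 = 1/3` in `Gal(ℚ(E′[3])/ℚ)` (times `1/2` for inertness in `K`). -/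
theorem card_nonscalar_unipotent_gl2_f3 :
    (Finset.univ.filter (fun T : Matrix (Fin 2) (Fin 2) (ZMod 3) =>
      T.det ≠ 0 ∧ (((T - 1) ^ 2 = 0 ∧ T ≠ 1) ∨ ((T + 1) ^ 2 = 0 ∧ T ≠ -1)))).card = 16 := by
  decide

/-- Every non-scalar `±`unipotent `T` has `det T = 1`: for `T = ρ̄₃(Frob_ℓ)` this is `ℓ ≡ 1 (mod 3)`, i.e. clause (3♭) is automatic. -/
theorem det_eq_one_of_nonscalar_unipotent :
    ∀ T : Matrix (Fin 2) (Fin 2) (ZMod 3),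
      (((T - 1) ^ 2 = 0 ∧ T ≠ 1) ∨ ((T + 1) ^ 2 = 0 ∧ T ≠ -1)) → T.det = 1 := by
  decide

set_option maxRecDepth 20000 in
/-- The rank-one shape at `n = 1` (BD05 Lemma 2.6's conclusion without its clause (3)): for every non-scalar `±`unipotent `T ∈ GL₂(𝔽₃)`,
`T² − 1` has rank exactly one (nonzero, determinant `0`) — so `H¹_fin(K_ℓ, E′[3]) = coker(Frob_{K_ℓ} − 1)` is a LINE — and
`T² − (det T)²` is nonzero of determinant `0` — so `H¹_sing(K_ℓ, E′[3]) ≅ ker(Frob_{K_ℓ} − ℓ²)` is a LINE.  Contrast: for scalar `T = ±1`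
and for the `ℓ ≡ −1` shape (`T² = 1`) both are planes (rank two: useless, as for Sweeting's Taylor-admissible primes). -/
theorem rankOne_shape_n1_fin :
    ∀ T : Matrix (Fin 2) (Fin 2) (ZMod 3),
      (((T - 1) ^ 2 = 0 ∧ T ≠ 1) ∨ ((T + 1) ^ 2 = 0 ∧ T ≠ -1)) → (T ^ 2 - 1 ≠ 0 ∧ (T ^ 2 - 1).det = 0) := by
  decide

set_option maxRecDepth 20000 in
/-- Singular half of `rankOne_shape_n1_fin` (there `det T = 1`, so `T² − (det T)² = T² − 1`; recorded in the cohomological normal form). -/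
theorem rankOne_shape_n1_sing :
    ∀ T : Matrix (Fin 2) (Fin 2) (ZMod 3),
      (((T - 1) ^ 2 = 0 ∧ T ≠ 1) ∨ ((T + 1) ^ 2 = 0 ∧ T ≠ -1)) →
        (T ^ 2 - (T.det ^ 2) • (1 : Matrix (Fin 2) (Fin 2) (ZMod 3)) ≠ 0 ∧ (T ^ 2 - (T.det ^ 2) • (1 : Matrix (Fin 2) (Fin 2) (ZMod 3))).det = 0) := by
  decide

/-- Contrast (why `ℓ ≡ −1 (mod 3)` / scalar Frobenius is useless): if `T² = 1` then `T² − 1 = 0`, i.e. `H¹_fin(K_ℓ, E′[3])` is all of `E′[3]` (rank two). -/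
theorem rankTwo_of_sq_eq_one : ∀ T : Matrix (Fin 2) (Fin 2) (ZMod 3), T ^ 2 = 1 → T ^ 2 - 1 = 0 := by
  intro T h; rw [h, sub_self]

end Summit.BirchSwinnertonDyer.BirchSwinnertonDyer.Cruxes.TwinAlgMuZeroAtThree.UnipotentBipartite.Instrument

end Instrument

noncomputable section

open scoped Classical Pointwise ContRepresentation TensorProduct NumberField

set_option linter.dupNamespace false
set_option autoImplicit false

namespace Summit.BirchSwinnertonDyer.BirchSwinnertonDyer.Cruxes.TwinAlgMuZeroAtThree.UnipotentBipartite

open NumberField IsDedekindDomain Field WeierstrassCurve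
open Literature.NumberTheory.EllipticCurves Literature.NumberTheory.EllipticCurves.GreenbergSelmer
  Literature.NumberTheory.EllipticCurves.IwasawaAlgebra
open Summit.BirchSwinnertonDyer.Rank1Residual.X11b Summit.BirchSwinnertonDyer.Rank1Residual.X11b.AcSelmer
open Summit.BirchSwinnertonDyer.BirchSwinnertonDyer.Theorems.UniversalToricDescentAcDualMuZero
open Summit.BirchSwinnertonDyer.BirchSwinnertonDyer.Theorems
open Summit.BirchSwinnertonDyer.BirchSwinnertonDyer.Theorems.UniversalToricDescentTwinAlgMuZeroAtThreeOfBetaRoad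
open Summit.BirchSwinnertonDyer.BirchSwinnertonDyer.Theorems.UniversalToricDescentTwinAlgMuZeroAtThreeOfBetaRoadParam
open Literature.NumberTheory.EllipticCurves.ZpExtension Literature.NumberTheory.EllipticCurves.Castella2024
open Summit.BirchSwinnertonDyer.BirchSwinnertonDyer.Theorems.UniversalToricDescentStrictPlace
open Summit.BirchSwinnertonDyer.BirchSwinnertonDyer.Theorems.UniversalToricDescentTowerTorsion
open Literature.NumberTheory.EllipticCurves.ModularForms (ModularParametrizationData)
open Literature Literature.NumberTheory.GaloisCohomology Literature.NumberTheory.GaloisCohomology.Howard2004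
open Literature.NumberTheory.GaloisRepresentations Literature.NumberTheory.GaloisRepresentations.DiscreteGaloisModule

/-! ## 0. The new object: unipotent-admissible primes at `p = 3` -/

/-- **Unipotent `n`-admissible primes at `p = 3`** relative to the level `N` (the conductor of the twin `W'`), the imaginary quadratic field `K`
and the globally minimal curve `W'`: `ℓ` prime; (1) `ℓ ∤ 3N`; (2) `ℓ` inert in `K`; (3♭) `3 ∣ ℓ − 1` (the OPPOSITE of BD05's (3) `p ∤ ℓ² − 1`,
which no prime satisfies at `p = 3`); (4) `3ⁿ ∣ ℓ + 1 − a_ℓ` or `3ⁿ ∣ ℓ + 1 + a_ℓ` (verbatim); (5) `ρ̄₃(Frob_ℓ)` is NOT semisimple — rendered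
arithmetically: the `3`-torsion of `E′(𝔽_{ℓ²})` has exactly `3` elements (Frobenius of `𝔽_{ℓ²}` is `F²`, unipotent mod `3` by (3♭)+(4), and
`ker(F² − 1 ∣ E′[3]) = ker N` is a line iff the nilpotent part `N ≠ 0`).  Notes: (i) given (3♭), (4) forces the characteristic polynomial of `F` on
`E′[3]` to be `(x ∓ 1)²`; (ii) Čebotarev-with-a-class (BD05 Thm. 3.2 analogue): for `s ∈ H¹(K, E′[3])` with `τ s = δ s` and `Frob_ℓ = (v, τ, T)`,
`T = ε(1 + N)`, one has `loc_ℓ(s) ≡ (1 + δε) v + δε N v (mod N·E′[3])`, nonzero iff `ε = δ` and `v ∉ ker N`.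
[cite: BertoliniDarmon2005, p. 18 (Admissible primes), Lemma 2.6, Remark 2 p. 19, Thm. 3.2 p. 22] -/
def IsUnipotentAdmissiblePrime (N : ℕ) (K : Type) [Field K] (W' : WeierstrassCurve ℚ) [W'.IsGloballyMinimal] (n ℓ : ℕ) : Prop :=
  ℓ.Prime ∧ ¬ ℓ ∣ 3 * N ∧ (Ideal.span {(ℓ : 𝓞 K)}).IsPrime ∧ (3 : ℤ) ∣ (ℓ : ℤ) - 1 ∧
    ((3 : ℤ) ^ n ∣ (ℓ : ℤ) + 1 - W'.frobeniusTrace ℓ ∨ (3 : ℤ) ^ n ∣ (ℓ : ℤ) + 1 + W'.frobeniusTrace ℓ) ∧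
    ∀ [Fact ℓ.Prime],
      Nat.card {P : ((integralModelInt W').map (Int.castRingHom (GaloisField ℓ 2))).toAffine.Point // 3 • P = 0} = 3

/-- A unipotent-admissible prime is never BD-admissible (clause (3♭) contradicts (3)); recorded to make the barrier placement explicit:
this object lies OUTSIDE `NoAdmissiblePrimesAtThree`'s set, which is empty. [cite: BertoliniDarmon2005, p. 18 (Admissible primes) (3)] -/
theorem not_isAdmissiblePrime_of_isUnipotentAdmissiblePrime {N : ℕ} {K : Type} [Field K] {W' : WeierstrassCurve ℚ}
    [W'.IsGloballyMinimal] {n ℓ : ℕ} (h : IsUnipotentAdmissiblePrime N K W' n ℓ) (a : ℕ → ℤ) (m : ℕ) :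
    ¬ BertoliniDarmon2005.IsAdmissiblePrime N K a 3 m ℓ := by
  intro h'
  obtain ⟨-, -, -, h3, -⟩ := h
  have h3' := (BertoliniDarmon2005.isAdmissiblePrime_iff.mp h').2.2.2.1
  apply h3'
  have : ((ℓ : ℤ) ^ 2 - 1) = ((ℓ : ℤ) - 1) * ((ℓ : ℤ) + 1) := by ring
  rw [this]
  exact dvd_mul_of_dvd_left h3 _

/-! ## 1. The stubs -/

/-- **U2 · `UnipotentLocalRankOne`** — BD05 Lemma 2.6's conclusion WITHOUT its clause (3), as `2 × 2` linear algebra over `ℤ/3ⁿ`: for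
`F = ε·(1 c; 0 λ)` with `ε² = 1`, `c` a unit, `λ ≡ 1 (mod 3)` (the shape of a unipotent-admissible Frobenius in a basis through `ker(F − ε)`;
`det F = λ = ℓ`), the image of `F² − 1` (whose cokernel is `H¹_fin(K_ℓ, E′[3ⁿ])`) is the free rank-one summand spanned by a vector with unit
first coordinate, and the kernel of `F² − λ²` (which is `H¹_sing(K_ℓ, E′[3ⁿ]) = E′[3ⁿ](-1)^{Frob_ℓ²}`-shaped) is the free rank-one summand spanned by
a vector with unit first coordinate.  Witnesses: `u = (c(1+λ), λ²−1)`, `w = (1, (λ−1)/c)`. -/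
def UnipotentLocalRankOne : Prop :=
  ∀ (n : ℕ), 1 ≤ n → ∀ (ε c l : ZMod (3 ^ n)), ε ^ 2 = 1 → IsUnit c → (3 : ZMod (3 ^ n)) ∣ l - 1 →
    (∃ u : Fin 2 → ZMod (3 ^ n), IsUnit (u 0) ∧
      ∀ x : Fin 2 → ZMod (3 ^ n),
        (∃ y : Fin 2 → ZMod (3 ^ n), Matrix.mulVec (((!![ε, ε * c; 0, ε * l] : Matrix (Fin 2) (Fin 2) (ZMod (3 ^ n))) ^ 2 - 1)) y = x) ↔
          ∃ t : ZMod (3 ^ n), x = t • u) ∧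
    (∃ w : Fin 2 → ZMod (3 ^ n), IsUnit (w 0) ∧
      ∀ x : Fin 2 → ZMod (3 ^ n),
        Matrix.mulVec (((!![ε, ε * c; 0, ε * l] : Matrix (Fin 2) (Fin 2) (ZMod (3 ^ n))) ^ 2 - (l ^ 2) • 1)) x = 0 ↔
          ∃ t : ZMod (3 ^ n), x = t • w)

/-- `1 + l` is a unit in `ℤ/3ⁿ` when `3 ∣ l - 1` (it is `2 +` a nilpotent). -/
lemma isUnit_one_add_of_three_dvd_sub_one {n : ℕ} (l : ZMod (3 ^ n)) (hl : (3 : ZMod (3 ^ n)) ∣ l - 1) : IsUnit (1 + l) := by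
  obtain ⟨d, hd⟩ := hl
  have h3n : (3 : ZMod (3 ^ n)) ^ n = 0 := by
    have : ((3 ^ n : ℕ) : ZMod (3 ^ n)) = 0 := ZMod.natCast_self _
    exact_mod_cast this
  have h3 : IsNilpotent ((3 : ZMod (3 ^ n)) * d) := ⟨n, by rw [mul_pow, h3n, zero_mul]⟩
  have h2 : IsUnit (2 : ZMod (3 ^ n)) := by
    have h := (ZMod.isUnit_iff_coprime 2 (3 ^ n)).mpr (Nat.Coprime.pow_right n (by norm_num))
    exact_mod_cast h
  have : (1 + l : ZMod (3 ^ n)) = 2 + 3 * d := by linear_combination hd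
  rw [this]
  exact h3.isUnit_add_left_of_commute h2 (Commute.all _ _)

/-- **U1 `unipotentLocalRankOne` — PROVED** (the former stub `stub_unipotentLocalRankOne`, closed inside the node; pure linear algebra over `ZMod (3^n)`):
BD05 Lemma 2.6's rank-one conclusion at a unipotent-admissible prime, for every `n ≥ 1`, with the explicit generators
`u = (c(1+l), l²−1)` of `im(F²−1)` and `w = (1, c⁻¹(l−1))` of `ker(F²−l²)`. -/
theorem unipotentLocalRankOne : UnipotentLocalRankOne := by
  intro n _hn ε c l hε hc hl
  have h1l : IsUnit (1 + l) := isUnit_one_add_of_three_dvd_sub_one l hl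
  -- the two matrices, computed
  have hF2 : ((!![ε, ε * c; 0, ε * l] : Matrix (Fin 2) (Fin 2) (ZMod (3 ^ n))) ^ 2 - 1)
      = !![0, c * (1 + l); 0, l ^ 2 - 1] := by
    ext i j
    fin_cases i <;> fin_cases j
    · simp [sq]
      linear_combination hε
    · simp [sq]
      linear_combination (c + c * l) * hε
    · simp [sq]
    · simp [sq]
      linear_combination l ^ 2 * hε
  have hF2' : ((!![ε, ε * c; 0, ε * l] : Matrix (Fin 2) (Fin 2) (ZMod (3 ^ n))) ^ 2 - (l ^ 2) • 1)
      = !![1 - l ^ 2, c * (1 + l); 0, 0] := by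
    ext i j
    fin_cases i <;> fin_cases j
    · simp [sq]
      linear_combination hε
    · simp [sq]
      linear_combination (c + c * l) * hε
    · simp [sq]
    · simp [sq]
      linear_combination l ^ 2 * hε
  have hmv : ∀ y : Fin 2 → ZMod (3 ^ n),
      Matrix.mulVec (!![0, c * (1 + l); 0, l ^ 2 - 1] : Matrix (Fin 2) (Fin 2) (ZMod (3 ^ n))) y
        = ![c * (1 + l) * y 1, (l ^ 2 - 1) * y 1] := by
    intro y
    funext i
    fin_cases i <;> simp [Matrix.mulVec, dotProduct, Fin.sum_univ_two]
  have hmv' : ∀ x : Fin 2 → ZMod (3 ^ n),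
      Matrix.mulVec (!![1 - l ^ 2, c * (1 + l); 0, 0] : Matrix (Fin 2) (Fin 2) (ZMod (3 ^ n))) x
        = ![(1 - l ^ 2) * x 0 + c * (1 + l) * x 1, 0] := by
    intro x
    funext i
    fin_cases i <;> simp [Matrix.mulVec, dotProduct, Fin.sum_univ_two]
  refine ⟨⟨![c * (1 + l), l ^ 2 - 1], ?_, ?_⟩, ⟨![1, ↑(hc.unit⁻¹) * (l - 1)], ?_, ?_⟩⟩
  · simpa using hc.mul h1l
  · intro x
    rw [hF2]
    constructor
    · rintro ⟨y, rfl⟩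
      refine ⟨y 1, ?_⟩
      rw [hmv]
      funext i
      fin_cases i <;> simp [mul_comm]
    · rintro ⟨t, rfl⟩
      refine ⟨![0, t], ?_⟩
      rw [hmv]
      funext i
      fin_cases i <;> simp [mul_comm]
  · simp
  · intro x
    rw [hF2', hmv']
    have hcc : (c : ZMod (3 ^ n)) * ↑(hc.unit⁻¹) = 1 := by
      simp
    constructor
    · intro h
      have h0 := congr_fun h 0
      simp at h0
      -- h0 : (1 - l ^ 2) * x 0 + c * (1 + l) * x 1 = 0
      have key : (1 + l) * ((1 - l) * x 0 + c * x 1) = 0 := by linear_combination h0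
      rw [h1l.mul_right_eq_zero] at key
      refine ⟨x 0, ?_⟩
      funext i
      fin_cases i
      · simp
      · simp
        linear_combination (↑(hc.unit⁻¹) : ZMod (3 ^ n)) * key - x 1 * hcc
    · rintro ⟨t, rfl⟩
      funext i
      fin_cases i
      · simp
        linear_combination t * (l - 1) * (1 + l) * hcc
      · simp


/-- **U1 · `UnipotentAdmissibleSupplyAtThree`** — the Čebotarev supply at `n = 1`: for a globally minimal `W′/ℚ` with `ρ̄₃` onto `GL₂(𝔽₃)` and
conductor `N′`, and an imaginary quadratic `K` in which `3` splits (so `K ≠ ℚ(√−3)` = the unique quadratic subfield of `ℚ(E′[3])`), there are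
unipotent `1`-admissible primes beyond every bound.  (Density `1/6`: `ℓ` inert (`1/2`) × `ρ̄₃(Frob_ℓ)` of order `3` or `6` (`16/48`); such
elements lie in `SL₂(𝔽₃)`, so `ℓ ≡ 1 (mod 3)` and (4) at `n = 1` are automatic.)  Higher `n` is NOT asserted (it would need the `3`-adic image;
Elkies arXiv:math/0612734) and is not needed downstream (module docstring: `3 = π^m·u` in `S_m` and K1 bounds the index by `m`). -/
def UnipotentAdmissibleSupplyAtThree : Prop :=
  ∀ (W' : WeierstrassCurve ℚ) [W'.IsElliptic] [W'.IsGloballyMinimal] (N' : ℕ) (K : Type) [Field K] [NumberField K],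
    W'.HasSurjectiveModNGaloisRep 3 → W'.conductorNorm ℤ = N' → IsImaginaryQuadratic K →
    ((Ideal.span {((3 : ℕ) : ℤ)}).primesOver (𝓞 K)).ncard = 2 →
    ∀ B : ℕ, ∃ ℓ : ℕ, B < ℓ ∧ IsUnipotentAdmissiblePrime N' K W' 1 ℓ

/-- **stub_unipotentAdmissibleSupply** (U1; WEAKER than the crux; ATTACKABLE from `Automorphic.chebotarev_artinRep_holds`; INSTRUMENTABLE on any
bucket-B twin). [cite: BertoliniDarmon2005, Thm. 3.2 (p. 22, the `p > 3` step replaced)] -/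
theorem stub_unipotentAdmissibleSupply : UnipotentAdmissibleSupplyAtThree := by
  sorry

/-- **K2♭ · `HowardConclusionOfFamilyMultAtThree`** — the ENGINE-AGNOSTIC form of beta-road's K2 on bucket B: the conclusion type of the tree theorem
`UniversalToricDescentTwinAlgMuZeroAtThreeOfBetaRoad.howardConclusionOfFamily_of_ksTwinLambda` WITHOUT its Kolyvagin-system hypothesis K2a‴ —
for every bucket-B twin frame and every norm-compatible Heegner family `F` with K1's local indivisibility at one degree-one `𝔭 ∋ 3`, the `Λ`-adic
datum `Dat`, the `Λ`-adic Heegner class `z` of `F`, and Howard's `Conclusion` at the control levels of `z` for all large `m`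
(`Stmt.conclusionAtControlLevels 3 …`).  Any rank-one rigidity engine (Kolyvagin system, bipartite Euler system) targets this. -/
def HowardConclusionOfFamilyMultAtThree : Prop :=
  ∀ (W' : WeierstrassCurve ℚ) [W'.IsElliptic] [W'.IsGloballyMinimal] (N' : ℕ) [NeZero N']
    (K : Type) [Field K] [NumberField K],
    Rank1Residual.Mult W' 3 → ¬ 3 ∣ padicValInt 3 W'.minimalDiscriminantInt →
    ∀ (hsurj : W'.HasSurjectiveModNGaloisRep 3), W'.conductorNorm ℤ = N' → ∀ (hK : IsImaginaryQuadratic K),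
    SatisfiesHeegnerHypothesis N' K → Odd (NumberField.discr K) →
    ∀ (κ : ZpExtension K 3), κ.IsAnticyclotomic →
    ∀ (γ : absoluteGaloisGroup K) [hγ : Fact (κ.IsTopGenerator γ)]
      (𝔭 : HeightOneSpectrum (𝓞 K)), ((3 : ℕ) : 𝓞 K) ∈ 𝔭.asIdeal →
      𝔭.asIdeal.ramificationIdx (𝓞 ℚ) = 1 → 𝔭.asIdeal.inertiaDeg (𝓞 ℚ) = 1 →
    ∀ (jbar : AlgebraicClosure K →+* ℂ) (F : HeegnerFamily N' W' K κ jbar) (α : ℤ),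
      α ^ 2 = 1 → F.IsNormCompatible γ α →
      (∃ k : ℕ, ∀ (Q : geomPoints (W'.baseChange K))
        (hQ : ∀ σ ∈ κ.layerSubgroup k ⊓ decomp 𝔭, σ • ((3 : ℤ) • Q) = (3 : ℤ) • Q),
        (3 : ℤ) • Q = F.z k →
          (W'.baseChange K).kummerClassOver (κ.layerSubgroup k ⊓ decomp 𝔭) 3 Q hQ ≠ 0) →
    ∃ (Dat : (W'.baseChange K).LambdaAdicSelmerData κ γ) (z : Dat.S),
      IsLambdaAdicHeegnerClass Dat F α z ∧
      UniversalToricDescentTwinHowardConclusion.Stmt.conclusionAtControlLevels 3 N' W' K κ γ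
        hγ.out (baseChange_noPTorsion_of_surjective W' 3 hsurj K hK) Dat z

/-- **stub_bipartiteHowardConclusionAtThree** (K2♭-bip; UNDECIDED / IDEA-NEEDED — the research constant of this node, HARDEST): the local
rank-one structure (U2) and the supply (U1) of unipotent-admissible primes feed a bipartite Euler system at `p = 3`, `3 ∥ N′`, over the
principal Artinian rings `S_m/π^k` (`k ≤ m`), whose rigidity (Howard 2006 Thm. 3.2.3 shape; BD05 Thm. 4.1/4.2 reciprocity laws at the new primes)
yields Howard's `Conclusion` at the control levels of the `Λ`-adic Heegner class — i.e. K2♭.  Leaves L1–L4 in the module docstring.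
[cite: BertoliniDarmon2005, Lemma 2.6, Thm. 3.2, Thm. 4.1, Thm. 4.2] [cite: Howard2004HeegnerKolyvagin, Thm. 1.6.1 (the conclusion shape)] -/
theorem stub_bipartiteHowardConclusionAtThree :
    UnipotentLocalRankOne → UnipotentAdmissibleSupplyAtThree → HowardConclusionOfFamilyMultAtThree := by
  sorry

/-- **stub_principalHeegnerIndivisibleMult** (K1‴ = (β), BY NAME from beta_road v19; RESEARCH, instrument-decidable per instance).
[cite: Castella2024, §2.2 and Thm. 2.1] [cite: BertoliniDarmon1996, §2.5] -/
theorem stub_principalHeegnerIndivisibleMult :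
    UniversalToricDescentBetaRoadParamDefs.PrincipalHeegnerIndivisibleMultOfParamAtThree := by
  sorry

/-- **stub_goodSS** (C₀′, BY NAME from beta_road v19; the signed frame — line `signed_howard_half` decomposes it).
[cite: BurungaleCastellaSkinner2025, Thm. 4.2.1 (b), Prop. 4.2.2 (shape only)] -/
theorem stub_goodSS :
    UniversalToricDescentBetaRoadParamDefs.TwinAlgMuZeroAtThreeGoodSSOfParam := by
  sorry

/-! ## 2. The composition (sorry-free below this line) -/

set_option synthInstance.maxHeartbeats 80000 in
set_option maxHeartbeats 1600000 in
/-- **Bucket B of crux 24737 from K1‴ and the engine-agnostic K2♭** — the v19 chain `twinAlgMuZeroAtThree_mult_of_betaRoadParam` verbatim with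
`residualCorankLeOneMult_of_ksTwinLambda hK2` replaced by K2♭ + `twin_k2Res_of_conclusion_of_layerIndivisible` (p766849): K1(𝔭) · degree one of
`𝔭′` · K1(𝔭′) · K2_res · P_res (`BetaRoad.stub_residualLinkMult`, landed p745706) · `isTorsion_and_exists_generator_of_finite_pTorsion`.
[cite: Howard2004HeegnerKolyvagin, Thm. B, Thm. 2.3.1] [cite: GreenbergLNM1716, §1] -/
theorem twinAlgMuZeroAtThree_mult_of_howardConclusionFlat
    (hK1 : UniversalToricDescentBetaRoadParamDefs.PrincipalHeegnerIndivisibleMultOfParamAtThree)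
    (hK2 : HowardConclusionOfFamilyMultAtThree)
    (W' : WeierstrassCurve ℚ) [W'.IsElliptic] [W'.IsGloballyMinimal] (N' : ℕ) [NeZero N']
    (K : Type) [Field K] [NumberField K] (Dt' : ModularParametrizationData W' N')
    (hm : Rank1Residual.Mult W' 3) (htr : ¬ 3 ∣ padicValInt 3 W'.minimalDiscriminantInt)
    (hsurj : W'.HasSurjectiveModNGaloisRep 3) (hN : W'.conductorNorm ℤ = N') (hK : IsImaginaryQuadratic K)
    (hH : SatisfiesHeegnerHypothesis N' K) (hodd : Odd (NumberField.discr K))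
    (κ : ZpExtension K 3) (hκ : κ.IsAnticyclotomic)
    (γ : absoluteGaloisGroup K) [hγ : Fact (κ.IsTopGenerator γ)]
    (𝔭 : HeightOneSpectrum (𝓞 K)) (h𝔭 : ((3 : ℕ) : 𝓞 K) ∈ 𝔭.asIdeal)
    (he : 𝔭.asIdeal.ramificationIdx (𝓞 ℚ) = 1) (hf : 𝔭.asIdeal.inertiaDeg (𝓞 ℚ) = 1)
    (𝔭' : HeightOneSpectrum (𝓞 K)) (h𝔭' : ((3 : ℕ) : 𝓞 K) ∈ 𝔭'.asIdeal) (hne : 𝔭' ≠ 𝔭) :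
    Module.IsTorsion (IwasawaAlgebra 3) (XAc (W'.baseChange K) 3 κ 𝔭' ∅ γ) ∧
      ∃ g' : UnrSeries 3,
        (XAc.charIdeal (W'.baseChange K) 3 κ 𝔭' ∅ γ).map (PowerSeries.map (Halves.toUnr 3)) =
            Ideal.span {g'} ∧
          ∃ i : ℕ, ‖((PowerSeries.coeff i g' : unrIntegers 3) : ℂ_[3])‖ = 1 := by
  -- K1 at `𝔭` (from K1‴ and `Dt'`)
  obtain ⟨jbar, F, α, hα, hcoh, k, hk⟩ :=
    coherentBetaMult_of_principalIndivisibleOfParam hK1 W' N' K Dt' hm htr hsurj hN hK hH hodd κ hκ γ 𝔭 h𝔭 he hf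
  -- `𝔭′` is of degree one: `3 ∣ N′` (multiplicative) and `K` is Heegner for `N′`
  have h3N : (3 : ℕ) ∣ N' := hN ▸ dvd_conductorNorm_of_mult hm
  obtain ⟨he', hf'⟩ := degreeOne_of_dvd_of_heegner (p := 3) hK hH h3N h𝔭'
  -- K1 at `𝔭′` (from K1‴ and `Dt'`)
  obtain ⟨jbar', F', α', hα', hcoh', k', hk'⟩ :=
    coherentBetaMult_of_principalIndivisibleOfParam hK1 W' N' K Dt' hm htr hsurj hN hK hH hodd κ hκ γ 𝔭' h𝔭' he' hf'
  -- K2♭: the datum, the class, Howard's conclusion at its control levels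
  obtain ⟨Dat, z, hz, hconc⟩ := hK2 W' N' K hm htr hsurj hN hK hH hodd κ hκ γ 𝔭 h𝔭 he hf jbar F α hα hcoh ⟨k, hk⟩
  -- K1 at precision `3 = 3^1`
  have hK1' : ∃ k : ℕ, ∀ (Q : geomPoints (W'.baseChange K))
      (hQ : ∀ σ ∈ κ.layerSubgroup k ⊓ decomp 𝔭, σ • ((((3 : ℕ) : ℤ) ^ 1) • Q) = (((3 : ℕ) : ℤ) ^ 1) • Q),
      (((3 : ℕ) : ℤ) ^ 1) • Q = F.z k →
        (W'.baseChange K).kummerClassOver (κ.layerSubgroup k ⊓ decomp 𝔭) (((3 : ℕ) : ℤ) ^ 1) Q hQ ≠ 0 := by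
    have e31 : (((3 : ℕ) : ℤ) ^ 1) = 3 := by norm_num
    rw [e31]
    exact ⟨k, hk⟩
  -- K2_res (p766849)
  obtain ⟨C, hC⟩ :=
    UniversalToricDescentTwinK2ResOfConclusion.twin_k2Res_of_conclusion_of_layerIndivisible
      W' N' K hm hsurj hK hH κ hκ γ F hα Dat hz (decomp 𝔭) hK1' hconc
  -- P_res: the residual two-sided link (landed)
  have hfin : Set.Finite {s : selmerAc (W'.baseChange K) 3 κ 𝔭' ∅ | 3 • s = 0} :=
    Summit.BirchSwinnertonDyer.BirchSwinnertonDyer.Cruxes.TwinAlgMuZeroAtThree.BetaRoad.stub_residualLinkMult W' N' K hm htr hsurj hN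
      hK hH κ hκ γ 𝔭 h𝔭 he hf 𝔭' h𝔭' hne jbar F α k hα hcoh hk jbar' F' α' k' hα' hcoh' hk' C hC
  -- the landed receptacle
  haveI : (W'.baseChange K).IsElliptic := by rw [WeierstrassCurve.baseChange]; infer_instance
  exact isTorsion_and_exists_generator_of_finite_pTorsion (W'.baseChange K) 3 κ 𝔭' ∅ γ Set.finite_empty hfin

/-- **The crux BY NAME** from the node's pieces: bucket B via K1‴ + (U2, U1 ⟹ K2♭ by the bipartite stub) + the landed residual chain;
bucket C₀ via C₀′ BY NAME.  Mirrors `twinAlgMuZeroAtThree_of_betaRoadParamStubs` (v19), passing the crux's own `Dt'`. -/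
theorem TwinAlgMuZeroAtThree_of :
    Summit.BirchSwinnertonDyer.BirchSwinnertonDyer.Theses.UniversalToricDescent.TwinAlgMuZeroAtThree := by
  intro W' _ _ N' _ K _ _ Dt' hbucket hsurj hN hK hH hodd κ hκ γ _ 𝔭 h𝔭 he hf 𝔭' h𝔭' hne
  rcases hbucket with ⟨hm, htr⟩ | ⟨hss, ha⟩
  · exact twinAlgMuZeroAtThree_mult_of_howardConclusionFlat stub_principalHeegnerIndivisibleMult
      (stub_bipartiteHowardConclusionAtThree unipotentLocalRankOne stub_unipotentAdmissibleSupply)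
      W' N' K Dt' hm htr hsurj hN hK hH hodd κ hκ γ 𝔭 h𝔭 he hf 𝔭' h𝔭' hne
  · exact (UniversalToricDescentBetaRoadParamDefs.twinAlgMuZeroAtThreeGoodSSOfParam_iff.mp stub_goodSS)
      W' N' K Dt' hss ha hsurj hN hK hH hodd κ hκ γ 𝔭 h𝔭 he hf 𝔭' h𝔭' hne

/-! ## 3. Sanity: K2a‴ still implies K2♭ (the node WEAKENS beta-road's K2 slot, it does not replace K1) -/

/-- beta-road's K2a‴ implies the engine-agnostic K2♭ (tree theorem `howardConclusionOfFamily_of_ksTwinLambda`), so this node's stub set is implied by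
v19's: the bipartite engine is an ALTERNATIVE source for the same slot. -/
theorem howardConclusionFlat_of_ksTwinLambda (hK2 : UniversalToricDescentKsTwinLambdaDefs.KsTwinLambdaAdicAtThree) :
    HowardConclusionOfFamilyMultAtThree := by
  intro W' _ _ N' _ K _ _ hm htr hsurj hN hK hH hodd κ hκ γ hγ 𝔭 h𝔭 he hf jbar F α hα hcoh hK1
  exact howardConclusionOfFamily_of_ksTwinLambda hK2 W' N' K hm htr hsurj hN hK hH hodd κ hκ γ 𝔭 h𝔭 he hf jbar F α hα hcoh hK1

end Summit.BirchSwinnertonDyer.BirchSwinnertonDyer.Cruxes.TwinAlgMuZeroAtThree.UnipotentBipartite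

end
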